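import Literature.NumberTheory.Transcendental.DolbeaultFunSmulProofs
import Literature.Geometry.Kaehler.LocalPQForms
import Literature.Geometry.Kaehler.PluriharmonicLog
import HarnessLib

/-!
# The Leibniz rule for `∂̄` and a complex function; `∂̄(t α) = t ∂̄α` for holomorphic `t`

On a complex manifold `M` (holomorphic atlas on the complex normed space `E`, underlying real
`C^∞` structure), for a COMPLEX function `t : M → ℂ` and a complex `k`-form `α`:

* `extDerivWithin_fun_smul_complex`, `mextDeriv_fun_smul_complex_apply` — the Leibniz rule of the
  exterior derivative for a complex multiplier, `d(t • α) x = t x • dα x + (dt)ₓ ∧ α x`, with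
  `(dt)ₓ = fderivWithin ℝ (t ∘ e⁻¹) (range I) (e x) : E →L[ℝ] ℂ` the differential of `t` read in
  the chart `e` at `x` and `∧ = wedgeOne` (the convention of Mathlib's `extDeriv`); this is the
  complex-coefficient twin of the tree's `mextDeriv_fun_smul_apply` (real multiplier), Warner
  (1983), Thm. 2.20;
* the `(0,1)`-part `θ^{0,1} = ½(θ + i θ∘J)` of a complex covector `θ : E →L[ℝ] ℂ` (`J = i •`,
  written inline) is conjugate-linear (`complexCovector01_apply_smul`), `θ = θ^{1,0} + θ^{0,1}`
  (`complexCovector10_add_complexCovector01`), and `θ^{0,1} = 0` when `θ` is `ℂ`-linear (`complexCovector01_eq_zero_of_map_smul`);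
* `dolbeaultBar_fun_smul_complex_apply` — **the Leibniz rule for `∂̄`**:
  `∂̄(t • α) x = t x • ∂̄α x + (dt)ₓ^{0,1} ∧ α x` for `t` real-differentiable at `x` and `α` smooth
  (Voisin (2002), §2.3.3: the Leibniz rules of `∂`, `∂̄` follow from that of `d` by taking types;
  Huybrechts (2005), §2.6, Lemma 2.6.22 / the `∂̄`-operator on `A^{0,q}(E)`); proof exactly parallel
  to the tree's `dolbeault_fun_smul_apply` (per type component `d(t α^{p,q}) = t dα^{p,q} + dt ∧ α^{p,q}`,
  `dt = (dt)^{1,0} + (dt)^{0,1}`, and the `(p,q+1)`-projection keeps exactly `(dt)^{0,1} ∧ α^{p,q}`);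
* `dolbeaultBar_fun_smul_apply_of_mdifferentiableAt` — **for `t` HOLOMORPHIC at `x`,
  `∂̄(t • α) x = t x • ∂̄α x`** (`(dt)ₓ` is `ℂ`-linear, so its `(0,1)`-part vanishes): the rule
  `∂̄(f σ) = f ∂̄σ` for holomorphic `f` which makes `∂̄` well defined on sections of a holomorphic
  bundle presented by a holomorphic cocycle (Huybrechts (2005), proof of Prop. 2.6.23 / Def. 2.6.24:
  "`∂̄_E` is well defined since the transition functions are holomorphic"; Voisin (2002), §2.3.3,
  Lemma 2.34 and the Dolbeault complex of a holomorphic bundle, §4.3.1);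
* `dolbeaultBar_fun_smul_apply_of_mdifferentiableOn` — the local form actually consumed: for `t`
  holomorphic on an open `W` and `α` real-`C^∞` at the points of `W`, `∂̄(t • α) x = t x • ∂̄α x`
  at every `x ∈ W` (localisation by a bump function, `exists_isSmoothForm_eventuallyEq_of_smoothAt`,
  and locality of `∂̄`, `dolbeaultBar_congr_of_eventuallyEq`); with the companions
  `fun_smul_complex_mem_smoothFormsOn` / `MForm.SmoothAt.fun_smul_complex`.

Everything is proved; no definitions, no named facts.

## References

* C. Voisin, *Hodge Theory and Complex Algebraic Geometry I* (2002), §2.3.1, §2.3.3 (Lemma 2.34),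
  §4.3.1. [VoisinHodgeI2002]
* D. Huybrechts, *Complex Geometry* (2005), §1.3, §2.6 (Lemma 2.6.22, Prop. 2.6.23, Def. 2.6.24).
  [HuybrechtsCG2005]
* F. W. Warner, *Foundations of Differentiable Manifolds and Lie Groups* (1983), Thm. 2.20.
  [WarnerGTM94]
-/

noncomputable section

open scoped Manifold ContDiff Topology
open Set Finset ContinuousAlternatingMap Function Complex
open Literature.LinearAlgebra.Alternating Literature.Analysis.Complex
open Literature.NumberTheory.Transcendental

namespace Literature.Geometry.Kaehler

/-! ### Flat: `d(g β) = g dβ + dg ∧ β` for a complex multiplier -/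

section Flat

variable {V : Type*} [NormedAddCommGroup V] [NormedSpace ℝ V] {k : ℕ}

/-- **Leibniz rule for a complex function times a complex-valued form, flat and within a set**:
`d(g β) = g dβ + dg ∧ β` at a point of unique differentiability, `dg ∧ β = wedgeOne (Dg) β` with
`Dg : V →L[ℝ] ℂ` (product rule for `fderivWithin` with a normed-algebra-valued multiplier, then
`extDerivWithin = alternatizeUncurryFin ∘ fderivWithin`). [cite: WarnerGTM94, Thm. 2.20] -/
theorem extDerivWithin_fun_smul_complex {g : V → ℂ} {β : V → V [⋀^Fin k]→L[ℝ] ℂ} {s : Set V} {x : V}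
    (hg : DifferentiableWithinAt ℝ g s x) (hβ : DifferentiableWithinAt ℝ β s x)
    (hs : UniqueDiffWithinAt ℝ s x) :
    extDerivWithin (fun y ↦ g y • β y) s x =
      g x • extDerivWithin β s x + wedgeOne (fderivWithin ℝ g s x) (β x) := by
  simp only [extDerivWithin]
  rw [fderivWithin_fun_smul hs hg hβ, alternatizeUncurryFin_add, alternatizeUncurryFin_smul]
  rfl

end Flat

/-! ### The `(1,0)`- and `(0,1)`-parts of a complex covector -/

section Covector

variable {E : Type*} [NormedAddCommGroup E] [NormedSpace ℂ E]

/-! The `(1,0)`- and `(0,1)`-parts of a complex covector `θ : E →L[ℝ] ℂ` are written inline, as in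
`DolbeaultFunSmulProofs`: `θ^{1,0} = ½(θ - i θ∘J)` and `θ^{0,1} = ½(θ + i θ∘J)`, `J = i •` the complex
structure of `E` (`(I • ContinuousLinearMap.id ℂ E).restrictScalars ℝ`). -/

/-- Evaluation of the `(1,0)`-part. [folklore] -/
theorem complexCovector10_apply (θ : E →L[ℝ] ℂ) (w : E) :
    ((2⁻¹ : ℂ) • (θ - I • θ.comp ((I • ContinuousLinearMap.id ℂ E).restrictScalars ℝ))) w = 2⁻¹ * (θ w - I * θ (I • w)) := by
  simp [smul_eq_mul, mul_sub]

/-- Evaluation of the `(0,1)`-part. [folklore] -/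
theorem complexCovector01_apply (θ : E →L[ℝ] ℂ) (w : E) :
    ((2⁻¹ : ℂ) • (θ + I • θ.comp ((I • ContinuousLinearMap.id ℂ E).restrictScalars ℝ))) w = 2⁻¹ * (θ w + I * θ (I • w)) := by
  simp [smul_eq_mul, mul_add]

/-- `θ = θ^{1,0} + θ^{0,1}`. [cite: VoisinHodgeI2002, §2.3.1] -/
theorem complexCovector10_add_complexCovector01 (θ : E →L[ℝ] ℂ) :
    ((2⁻¹ : ℂ) • (θ - I • θ.comp ((I • ContinuousLinearMap.id ℂ E).restrictScalars ℝ))) + ((2⁻¹ : ℂ) • (θ + I • θ.comp ((I • ContinuousLinearMap.id ℂ E).restrictScalars ℝ))) = θ := by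
  ext w
  simp only [_root_.add_apply, complexCovector10_apply, complexCovector01_apply]
  ring

/-- A real-linear complex covector evaluated at `c • w`, through the real and imaginary parts of
`c`. [folklore] -/
theorem clm_apply_complex_smul (θ : E →L[ℝ] ℂ) (c : ℂ) (w : E) :
    θ (c • w) = (c.re : ℂ) * θ w + (c.im : ℂ) * θ (I • w) := by
  have hc : c • w = (c.re : ℝ) • w + (c.im : ℝ) • (I • w) := by
    conv_lhs => rw [← Complex.re_add_im c]
    rw [add_smul, ← Complex.coe_smul, mul_smul, ← Complex.coe_smul]
  rw [hc, map_add, θ.map_smul_of_tower, θ.map_smul_of_tower, Complex.real_smul, Complex.real_smul]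

/-- `θ (i • w)` at `c • w`: the companion of `clm_apply_complex_smul`. [folklore] -/
theorem clm_apply_I_smul_complex_smul (θ : E →L[ℝ] ℂ) (c : ℂ) (w : E) :
    θ (I • c • w) = -(c.im : ℂ) * θ w + (c.re : ℂ) * θ (I • w) := by
  rw [smul_smul, clm_apply_complex_smul θ (I * c) w]
  simp only [Complex.mul_re, Complex.mul_im, Complex.I_re, Complex.I_im, zero_mul, one_mul, zero_sub,
    zero_add, Complex.ofReal_neg]

/-- `c = re c + i im c` and `c̄ = re c - i im c`, as needed below. [folklore] -/
theorem conj_eq_re_sub_im_mul_I (c : ℂ) : (starRingEnd ℂ) c = (c.re : ℂ) - (c.im : ℂ) * I :=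
  Complex.ext (by simp) (by simp)

/-- The `(1,0)`-part is `ℂ`-linear: `θ^{1,0}(c • w) = c θ^{1,0}(w)`. [cite: VoisinHodgeI2002, §2.3.1] -/
theorem complexCovector10_apply_smul (θ : E →L[ℝ] ℂ) (c : ℂ) (w : E) :
    ((2⁻¹ : ℂ) • (θ - I • θ.comp ((I • ContinuousLinearMap.id ℂ E).restrictScalars ℝ))) (c • w) =
      c * ((2⁻¹ : ℂ) • (θ - I • θ.comp ((I • ContinuousLinearMap.id ℂ E).restrictScalars ℝ))) w := by
  rw [complexCovector10_apply, complexCovector10_apply, clm_apply_I_smul_complex_smul, clm_apply_complex_smul θ c w]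
  conv_rhs => rw [← Complex.re_add_im c]
  ring_nf
  rw [I_sq]
  ring

/-- The `(0,1)`-part is conjugate-linear: `θ^{0,1}(c • w) = c̄ θ^{0,1}(w)`. [cite: VoisinHodgeI2002, §2.3.1] -/
theorem complexCovector01_apply_smul (θ : E →L[ℝ] ℂ) (c : ℂ) (w : E) :
    ((2⁻¹ : ℂ) • (θ + I • θ.comp ((I • ContinuousLinearMap.id ℂ E).restrictScalars ℝ))) (c • w) =
      (starRingEnd ℂ) c * ((2⁻¹ : ℂ) • (θ + I • θ.comp ((I • ContinuousLinearMap.id ℂ E).restrictScalars ℝ))) w := by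
  rw [complexCovector01_apply, complexCovector01_apply, clm_apply_I_smul_complex_smul, clm_apply_complex_smul θ c w,
    conj_eq_re_sub_im_mul_I]
  ring_nf
  rw [I_sq]
  ring

/-- **A `ℂ`-linear covector has no `(0,1)`-part.** [cite: VoisinHodgeI2002, §2.3.1] -/
theorem complexCovector01_eq_zero_of_map_smul (θ : E →L[ℝ] ℂ) (hθ : ∀ w : E, θ (I • w) = I * θ w) :
    ((2⁻¹ : ℂ) • (θ + I • θ.comp ((I • ContinuousLinearMap.id ℂ E).restrictScalars ℝ))) = 0 := by
  ext w
  have h : ((2⁻¹ : ℂ) • (θ + I • θ.comp ((I • ContinuousLinearMap.id ℂ E).restrictScalars ℝ))) w = 0 := by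
    rw [complexCovector01_apply, hθ w, ← mul_assoc, I_mul_I]
    ring
  simpa using h

/-- The `(0,1)`-part of the restriction of scalars of a `ℂ`-linear covector vanishes. [folklore] -/
theorem complexCovector01_restrictScalars (θ : E →L[ℂ] ℂ) :
    ((2⁻¹ : ℂ) • ((θ.restrictScalars ℝ) + I • (θ.restrictScalars ℝ).comp ((I • ContinuousLinearMap.id ℂ E).restrictScalars ℝ))) = 0 :=
  complexCovector01_eq_zero_of_map_smul _ fun w ↦ by
    rw [ContinuousLinearMap.coe_restrictScalars', θ.map_smul, smul_eq_mul]

end Covector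

/-! ### Manifold: complex multipliers, `d(t • α)` and smoothness -/

section Manifold

variable {E : Type*} [NormedAddCommGroup E] [NormedSpace ℂ E]
  {M : Type*} [TopologicalSpace M] [ChartedSpace E M] {k : ℕ}

/-- The chart representative of `t • α` is `(t ∘ e.symm) • α̂`. [folklore] -/
theorem MForm.inChart_fun_smul_complex (t : M → ℂ) (α : MForm 𝓘(ℝ, E) M ℂ k) (x₀ : M) :
    (t • α).inChart x₀ = fun y ↦ t ((extChartAt 𝓘(ℝ, E) x₀).symm y) • α.inChart x₀ y := by
  funext y
  ext v
  simp only [MForm.inChart_apply, Pi.smul_apply']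
  rfl

/-- Pointwise value of `t • α`. [folklore] -/
theorem MForm.fun_smul_complex_apply (t : M → ℂ) (α : MForm 𝓘(ℝ, E) M ℂ k) (x : M) :
    (t • α) x = t x • α x :=
  rfl

/-- **A real-`C^∞` complex function times a form smooth at `x` is smooth at `x`.** [folklore] -/
theorem MForm.SmoothAt.fun_smul_complex {t : M → ℂ} {α : MForm 𝓘(ℝ, E) M ℂ k} {x : M}
    (ht : ContMDiffAt 𝓘(ℝ, E) 𝓘(ℝ, ℂ) ∞ t x) (hα : α.SmoothAt x) : (t • α).SmoothAt x := by
  have h1 : ContDiffWithinAt ℝ ∞ (t ∘ (extChartAt 𝓘(ℝ, E) x).symm) (range 𝓘(ℝ, E))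
      (extChartAt 𝓘(ℝ, E) x x) := by
    simpa using (contMDiffAt_iff.1 ht).2
  rw [MForm.SmoothAt, MForm.inChart_fun_smul_complex]
  exact h1.smul hα

/-- **A complex function real-`C^∞` on `W` times a form on `W` is a form on `W`** (`smoothFormsOn`).
[folklore] -/
theorem fun_smul_complex_mem_smoothFormsOn {W : Set M} {t : M → ℂ}
    (ht : ∀ x ∈ W, ContMDiffAt 𝓘(ℝ, E) 𝓘(ℝ, ℂ) ∞ t x) {α : MForm 𝓘(ℝ, E) M ℂ k}
    (hα : α ∈ smoothFormsOn 𝓘(ℝ, E) ℂ W k) : t • α ∈ smoothFormsOn 𝓘(ℝ, E) ℂ W k :=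
  ⟨fun x hx ↦ (hα.1 x hx).fun_smul_complex (ht x hx),
    fun x hx ↦ by rw [MForm.fun_smul_complex_apply, hα.2 x hx, smul_zero]⟩

/-- A complex function differentiable at `x` (manifold sense, real structure) is differentiable
within `range I` at the chart point when read in the chart at `x`. [folklore] -/
theorem differentiableWithinAt_comp_extChartAt_symm_of_mdifferentiableAt_complex {t : M → ℂ} {x : M}
    (ht : MDifferentiableAt 𝓘(ℝ, E) 𝓘(ℝ, ℂ) t x) :
    DifferentiableWithinAt ℝ (t ∘ (extChartAt 𝓘(ℝ, E) x).symm) (range 𝓘(ℝ, E)) (extChartAt 𝓘(ℝ, E) x x) := by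
  have h := ((mdifferentiableAt_iff t x).1 ht).2
  simpa only [writtenInExtChartAt, extChartAt_model_space_eq_id, PartialEquiv.refl_coe,
    Function.id_comp] using h

/-- **Leibniz rule for a complex function times a form on a complex manifold, at a point**:
`d(t • α) x v = t x • dα x v + ((dt)ₓ ∧ α x) v`, `(dt)ₓ = D(t ∘ e⁻¹)(e x) : E →L[ℝ] ℂ` the real
differential of `t` read in the chart at `x`. Warner (1983), Thm. 2.20 (complex coefficients).
[cite: WarnerGTM94, Thm. 2.20] -/
theorem mextDeriv_fun_smul_complex_apply {t : M → ℂ} {α : MForm 𝓘(ℝ, E) M ℂ k} {x : M}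
    (ht : MDifferentiableAt 𝓘(ℝ, E) 𝓘(ℝ, ℂ) t x) (hα : α.SmoothAt x)
    (v : Fin (k + 1) → TangentSpace 𝓘(ℝ, E) x) :
    mextDeriv (t • α) x v = t x • mextDeriv α x v +
      wedgeOne (fderivWithin ℝ (t ∘ (extChartAt 𝓘(ℝ, E) x).symm) (range 𝓘(ℝ, E)) (extChartAt 𝓘(ℝ, E) x x))
        (show E [⋀^Fin k]→L[ℝ] ℂ from α x) v := by
  have hU : UniqueDiffWithinAt ℝ (range 𝓘(ℝ, E)) (extChartAt 𝓘(ℝ, E) x x) :=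
    𝓘(ℝ, E).uniqueDiffOn _ (extChartAt_target_subset_range x (mem_extChartAt_target x))
  have hx : t ((extChartAt 𝓘(ℝ, E) x).symm (extChartAt 𝓘(ℝ, E) x x)) = t x := by rw [extChartAt_to_inv]
  have hflat : extDerivWithin ((t • α).inChart x) (range 𝓘(ℝ, E)) (extChartAt 𝓘(ℝ, E) x x) =
      t x • extDerivWithin (α.inChart x) (range 𝓘(ℝ, E)) (extChartAt 𝓘(ℝ, E) x x) +
        wedgeOne (fderivWithin ℝ (t ∘ (extChartAt 𝓘(ℝ, E) x).symm) (range 𝓘(ℝ, E)) (extChartAt 𝓘(ℝ, E) x x))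
          (α.inChart x (extChartAt 𝓘(ℝ, E) x x)) := by
    rw [MForm.inChart_fun_smul_complex,
      extDerivWithin_fun_smul_complex (g := fun y ↦ t ((extChartAt 𝓘(ℝ, E) x).symm y))
        (differentiableWithinAt_comp_extChartAt_symm_of_mdifferentiableAt_complex ht) (hα.differentiableWithinAt (by simp)) hU,
      hx]
    rfl
  have h := congrArg (fun w : E [⋀^Fin (k + 1)]→L[ℝ] ℂ ↦ w v)
    ((mextDeriv_eq_extDerivWithin_of_chartedSpace (t • α) x).trans hflat)
  simp only [ContinuousAlternatingMap.add_apply, inChart_apply_self_of_chartedSpace,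
    ← mextDeriv_eq_extDerivWithin_of_chartedSpace] at h
  exact h

/-- Type components commute with multiplication by complex functions:
`(t • α)^{p,q} = t • α^{p,q}`. [folklore] -/
theorem typeComponent_fun_smul_complex (p q : ℕ) (t : M → ℂ) (α : MForm 𝓘(ℝ, E) M ℂ k) :
    (t • α).typeComponent p q = t • α.typeComponent p q := by
  funext x
  have h1 : (show E [⋀^Fin k]→L[ℝ] ℂ from (t • α).typeComponent p q x) =
      t x • (show E [⋀^Fin k]→L[ℝ] ℂ from α.typeComponent p q x) := by
    rw [typeComponent_apply_eq_typeProjAt, typeComponent_apply_eq_typeProjAt, ← typeProjAt_smul]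
    rfl
  exact h1

/-! ### The Leibniz rule for `∂̄` -/

section Leibniz

variable [IsManifold 𝓘(ℂ, E) ω M] [IsManifold 𝓘(ℝ, E) ∞ M]

omit [IsManifold 𝓘(ℂ, E) ω M] [IsManifold 𝓘(ℝ, E) ∞ M] in
/-- Unfolding of `∂̄` at a point on a tuple: `∂̄α x v = ∑_{p+q=k} ((dα^{p,q})^{p,q+1}) x v`. [folklore] -/
theorem dolbeaultBar_apply_apply (α : MForm 𝓘(ℝ, E) M ℂ k) (x : M)
    (v : Fin (k + 1) → TangentSpace 𝓘(ℝ, E) x) :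
    dolbeaultBar α x v = ∑ pq ∈ antidiagonal k,
      (mextDeriv (α.typeComponent pq.1 pq.2)).typeComponent pq.1 (pq.2 + 1) x v := by
  rw [dolbeaultBar, Finset.sum_apply, ContinuousAlternatingMap.sum_apply]

/-- **Leibniz rule for `∂̄` and a complex function**: for `t` real-differentiable at `x` and `α` a
smooth complex `k`-form, `∂̄(t • α) x v = t x • ∂̄α x v + ((dt)ₓ^{0,1} ∧ α x) v`, where
`(dt)ₓ^{0,1} = ½(D + i D∘J)`, `D = D(t ∘ e⁻¹)(e x)`, is the `(0,1)`-part of the chart differential of `t`.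
Per type component `d(t α^{p,q}) = t dα^{p,q} + dt ∧ α^{p,q}` (`mextDeriv_fun_smul_complex_apply`),
`dt = (dt)^{1,0} + (dt)^{0,1}` with `(dt)^{1,0} ∧ α^{p,q}` of type `(p+1,q)` and
`(dt)^{0,1} ∧ α^{p,q}` of type `(p,q+1)`, so the `(p,q+1)`-projection keeps the latter; sum over the
antidiagonal. Voisin (2002), §2.3.3; Huybrechts (2005), §2.6. [cite: VoisinHodgeI2002, §2.3.3] -/
theorem dolbeaultBar_fun_smul_complex_apply {t : M → ℂ} {α : MForm 𝓘(ℝ, E) M ℂ k} {x : M}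
    (ht : MDifferentiableAt 𝓘(ℝ, E) 𝓘(ℝ, ℂ) t x) (hα : IsSmoothForm α)
    (v : Fin (k + 1) → TangentSpace 𝓘(ℝ, E) x) :
    dolbeaultBar (t • α) x v = t x • dolbeaultBar α x v +
      wedgeOne ((2⁻¹ : ℂ) •
          (fderivWithin ℝ (t ∘ (extChartAt 𝓘(ℝ, E) x).symm) (range 𝓘(ℝ, E)) (extChartAt 𝓘(ℝ, E) x x) +
            I • (fderivWithin ℝ (t ∘ (extChartAt 𝓘(ℝ, E) x).symm) (range 𝓘(ℝ, E))
              (extChartAt 𝓘(ℝ, E) x x)).comp ((I • ContinuousLinearMap.id ℂ E).restrictScalars ℝ)))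
        (show E [⋀^Fin k]→L[ℝ] ℂ from α x) v := by
  set D : E →L[ℝ] ℂ := fderivWithin ℝ (t ∘ (extChartAt 𝓘(ℝ, E) x).symm) (range 𝓘(ℝ, E))
    (extChartAt 𝓘(ℝ, E) x x) with hD
  /- Step 1: per type component, as an identity of `E`-forms. -/
  have key : ∀ pq ∈ antidiagonal k,
      (show E [⋀^Fin (k + 1)]→L[ℝ] ℂ from
          (mextDeriv ((t • α).typeComponent pq.1 pq.2)).typeComponent pq.1 (pq.2 + 1) x) =
        t x • (show E [⋀^Fin (k + 1)]→L[ℝ] ℂ from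
            (mextDeriv (α.typeComponent pq.1 pq.2)).typeComponent pq.1 (pq.2 + 1) x) +
          wedgeOne ((2⁻¹ : ℂ) • (D + I • D.comp ((I • ContinuousLinearMap.id ℂ E).restrictScalars ℝ))) (show E [⋀^Fin k]→L[ℝ] ℂ from α.typeComponent pq.1 pq.2 x) := by
    intro pq hpq
    have hpq' : pq.1 + pq.2 = k := mem_antidiagonal.1 hpq
    have hsm : (α.typeComponent pq.1 pq.2).SmoothAt x :=
      isSmoothForm_typeComponent_holds pq.1 pq.2 hα x
    -- `d(t α^{pq}) x = t x • dα^{pq} x + dt ∧ α^{pq} x`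
    have hd : (show E [⋀^Fin (k + 1)]→L[ℝ] ℂ from mextDeriv ((t • α).typeComponent pq.1 pq.2) x) =
        t x • (show E [⋀^Fin (k + 1)]→L[ℝ] ℂ from mextDeriv (α.typeComponent pq.1 pq.2) x) +
          wedgeOne D (show E [⋀^Fin k]→L[ℝ] ℂ from α.typeComponent pq.1 pq.2 x) := by
      rw [typeComponent_fun_smul_complex]
      ext w
      change mextDeriv (t • α.typeComponent pq.1 pq.2) x w = _
      rw [mextDeriv_fun_smul_complex_apply ht hsm w, ContinuousAlternatingMap.add_apply,
        ContinuousAlternatingMap.smul_apply, ← hD]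
      rfl
    -- types of the two halves of `dt ∧ α^{pq}`
    have htα : IsOfTypeAt pq.1 pq.2 (show E [⋀^Fin k]→L[ℝ] ℂ from α.typeComponent pq.1 pq.2 x) :=
      isOfTypeAt_typeComponent_apply hpq' α x
    have h10 : IsOfTypeAt (pq.1 + 1) pq.2
        (wedgeOne ((2⁻¹ : ℂ) • (D - I • D.comp ((I • ContinuousLinearMap.id ℂ E).restrictScalars ℝ))) (show E [⋀^Fin k]→L[ℝ] ℂ from α.typeComponent pq.1 pq.2 x)) :=
      htα.wedgeOne_of_linear fun c w ↦ complexCovector10_apply_smul D c w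
    have h01 : IsOfTypeAt pq.1 (pq.2 + 1)
        (wedgeOne ((2⁻¹ : ℂ) • (D + I • D.comp ((I • ContinuousLinearMap.id ℂ E).restrictScalars ℝ))) (show E [⋀^Fin k]→L[ℝ] ℂ from α.typeComponent pq.1 pq.2 x)) :=
      htα.wedgeOne_of_conj fun c w ↦ complexCovector01_apply_smul D c w
    rw [typeComponent_apply_eq_typeProjAt, hd, typeProjAt_add, typeProjAt_smul,
      ← complexCovector10_add_complexCovector01 D, wedgeOne_add_left, typeProjAt_add,
      h10.typeProjAt_of_ne (Or.inl (by omega)), zero_add, h01.typeProjAt_eq_self,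
      ← typeComponent_apply_eq_typeProjAt, complexCovector10_add_complexCovector01]
  /- Step 2: sum over the antidiagonal. -/
  have hsum : ∀ pq ∈ antidiagonal k,
      (mextDeriv ((t • α).typeComponent pq.1 pq.2)).typeComponent pq.1 (pq.2 + 1) x v =
        t x * (mextDeriv (α.typeComponent pq.1 pq.2)).typeComponent pq.1 (pq.2 + 1) x v +
          wedgeOne ((2⁻¹ : ℂ) • (D + I • D.comp ((I • ContinuousLinearMap.id ℂ E).restrictScalars ℝ))) (show E [⋀^Fin k]→L[ℝ] ℂ from α.typeComponent pq.1 pq.2 x) v :=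
    fun pq hpq ↦ congrArg (fun w : E [⋀^Fin (k + 1)]→L[ℝ] ℂ ↦ w v) (key pq hpq)
  have hαsum : ∑ pq ∈ antidiagonal k, (show E [⋀^Fin k]→L[ℝ] ℂ from α.typeComponent pq.1 pq.2 x) =
      (show E [⋀^Fin k]→L[ℝ] ℂ from α x) := by
    have := congr_fun (sum_antidiagonal_typeComponent_holds (E := E) (M := M) α) x
    rw [Finset.sum_apply] at this
    exact this
  rw [dolbeaultBar_apply_apply, dolbeaultBar_apply_apply, Finset.sum_congr rfl hsum,
    Finset.sum_add_distrib, ← Finset.mul_sum, smul_eq_mul, ← hαsum, ← wedgeOneL_apply, _root_.map_sum,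
    ContinuousAlternatingMap.sum_apply]
  simp only [wedgeOneL_apply]

omit [IsManifold 𝓘(ℂ, E) ω M] [IsManifold 𝓘(ℝ, E) ∞ M] in
/-- A function holomorphic at `x` is real-differentiable at `x` (manifold sense). [folklore] -/
theorem mdifferentiableAt_real_of_complex {t : M → ℂ} {x : M}
    (ht : MDifferentiableAt 𝓘(ℂ, E) 𝓘(ℂ, ℂ) t x) : MDifferentiableAt 𝓘(ℝ, E) 𝓘(ℝ, ℂ) t x := by
  rw [mdifferentiableAt_iff]
  refine ⟨ht.continuousAt, ?_⟩
  have h := (differentiableAt_comp_extChartAt_symm_of_mdifferentiableAt ht).restrictScalars ℝ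
  simp only [writtenInExtChartAt, extChartAt_model_space_eq_id, PartialEquiv.refl_coe, Function.id_comp,
    ModelWithCorners.Boundaryless.range_eq_univ, differentiableWithinAt_univ]
  exact h

omit [IsManifold 𝓘(ℂ, E) ω M] [IsManifold 𝓘(ℝ, E) ∞ M] in
/-- **The chart differential of a function holomorphic at `x` has no `(0,1)`-part**: it is the
restriction of scalars of the complex derivative. [cite: VoisinHodgeI2002, §2.3.3 Lemma 2.29] -/
theorem complexCovector01_fderivWithin_eq_zero_of_mdifferentiableAt {t : M → ℂ} {x : M}
    (ht : MDifferentiableAt 𝓘(ℂ, E) 𝓘(ℂ, ℂ) t x) :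
    (2⁻¹ : ℂ) • (fderivWithin ℝ (t ∘ (extChartAt 𝓘(ℝ, E) x).symm) (range 𝓘(ℝ, E)) (extChartAt 𝓘(ℝ, E) x x) +
        I • (fderivWithin ℝ (t ∘ (extChartAt 𝓘(ℝ, E) x).symm) (range 𝓘(ℝ, E))
          (extChartAt 𝓘(ℝ, E) x x)).comp ((I • ContinuousLinearMap.id ℂ E).restrictScalars ℝ)) = 0 := by
  have hC := differentiableAt_comp_extChartAt_symm_of_mdifferentiableAt ht
  rw [ModelWithCorners.Boundaryless.range_eq_univ, fderivWithin_univ,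
    (hC.hasFDerivAt.restrictScalars ℝ).fderiv]
  exact complexCovector01_restrictScalars _

/-- **`∂̄(t • α) = t • ∂̄α` at a point where `t` is holomorphic** (for a smooth complex form `α`):
the `(0,1)`-part of the chart differential of `t` vanishes. This is the rule `∂̄(f σ) = f ∂̄σ` for
holomorphic `f` (Huybrechts (2005), proof of Prop. 2.6.23; Voisin (2002), §2.3.3 Lemma 2.34).
[cite: HuybrechtsCG2005, Prop. 2.6.23] -/
theorem dolbeaultBar_fun_smul_apply_of_mdifferentiableAt {t : M → ℂ} {α : MForm 𝓘(ℝ, E) M ℂ k}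
    {x : M} (ht : MDifferentiableAt 𝓘(ℂ, E) 𝓘(ℂ, ℂ) t x) (hα : IsSmoothForm α) :
    dolbeaultBar (t • α) x = t x • dolbeaultBar α x := by
  ext v
  rw [dolbeaultBar_fun_smul_complex_apply (mdifferentiableAt_real_of_complex ht) hα v,
    complexCovector01_fderivWithin_eq_zero_of_mdifferentiableAt ht, ContinuousAlternatingMap.smul_apply]
  have h0 : wedgeOne (0 : E →L[ℝ] ℂ) (show E [⋀^Fin k]→L[ℝ] ℂ from α x) = 0 := by
    rw [← zero_smul ℂ (0 : E →L[ℝ] ℂ), wedgeOne_smul_left, zero_smul]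
  rw [h0]
  exact add_zero _

/-! ### Local forms: `t` holomorphic on an open `W`, `α` smooth on `W` -/

omit [IsManifold 𝓘(ℂ, E) ω M] in
/-- **Localisation**: a form smooth at the points of an open `W` agrees near each `x ∈ W` with a
GLOBALLY smooth form (`f • α` for a smooth bump function `f` equal to `1` near `x` with
`tsupport f ⊆ W`; cf. the tree's `exists_isSmoothForm_eventuallyEq`, which also asks `α = 0` off
`W`). [folklore] -/
theorem exists_isSmoothForm_eventuallyEq_of_smoothAt [FiniteDimensional ℂ E] [T2Space M] {W : Set M}
    (hW : IsOpen W) {α : MForm 𝓘(ℝ, E) M ℂ k} (hα : ∀ z ∈ W, α.SmoothAt z) {x : M} (hx : x ∈ W) :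
    ∃ β : MForm 𝓘(ℝ, E) M ℂ k, IsSmoothForm β ∧ ∀ᶠ z in 𝓝 x, β z = α z := by
  obtain ⟨f, -, hf⟩ := (SmoothBumpFunction.nhds_basis_tsupport (I := 𝓘(ℝ, E)) x).mem_iff.1
    (hW.mem_nhds hx)
  refine ⟨(f : M → ℝ) • α, fun z ↦ ?_, ?_⟩
  · by_cases hz : z ∈ W
    · exact (hα z hz).fun_smul f.contMDiff.contMDiffAt
    · have h0 : (f : M → ℝ) =ᶠ[𝓝 z] 0 := notMem_tsupport_iff_eventuallyEq.1 fun h ↦ hz (hf h)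
      refine MForm.smoothAt_of_eventuallyEq_zero ?_
      filter_upwards [h0] with w hw
      rw [Pi.smul_apply', hw, Pi.zero_apply, zero_smul]
  · filter_upwards [f.eventuallyEq_one] with z hz
    rw [Pi.smul_apply', hz, Pi.one_apply, one_smul]

/-- **`∂̄(t • α) x = t x • ∂̄α x` on an open set `W` where `t` is holomorphic and `α` is a form on
`W`** (real-`C^∞` at the points of `W`). Localisation: near `x ∈ W` the form `α` agrees with a
globally smooth form (`exists_isSmoothForm_eventuallyEq_of_smoothAt`), hence so do
`t • α` and `t •` that form; `∂̄` is local (`dolbeaultBar_congr_of_eventuallyEq`).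
[cite: HuybrechtsCG2005, Prop. 2.6.23] -/
theorem dolbeaultBar_fun_smul_apply_of_mdifferentiableOn [FiniteDimensional ℂ E] [T2Space M] {W : Set M}
    (hW : IsOpen W) {t : M → ℂ} (ht : MDifferentiableOn 𝓘(ℂ, E) 𝓘(ℂ, ℂ) t W) {α : MForm 𝓘(ℝ, E) M ℂ k}
    (hα : ∀ z ∈ W, α.SmoothAt z) {x : M} (hx : x ∈ W) :
    dolbeaultBar (t • α) x = t x • dolbeaultBar α x := by
  obtain ⟨β, hβ, hβα⟩ := exists_isSmoothForm_eventuallyEq_of_smoothAt hW hα hx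
  have h1 : ∀ᶠ z in 𝓝 x, (t • α) z = (t • β) z := by
    filter_upwards [hβα] with z hz
    rw [MForm.fun_smul_complex_apply, MForm.fun_smul_complex_apply, hz]
  rw [dolbeaultBar_congr_of_eventuallyEq h1,
    dolbeaultBar_fun_smul_apply_of_mdifferentiableAt ((ht x hx).mdifferentiableAt (hW.mem_nhds hx)) hβ,
    dolbeaultBar_congr_of_eventuallyEq (hβα.mono fun z hz ↦ hz.symm)]

omit [IsManifold 𝓘(ℝ, E) ∞ M] in
/-- A function holomorphic on an open `W` is real-`C^∞` at its points, so `t • α` is a form on `W`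
whenever `α` is. [folklore] -/
theorem fun_smul_mem_smoothFormsOn_of_mdifferentiableOn [FiniteDimensional ℂ E] [IsManifold 𝓘(ℝ, E) ∞ M]
    {W : Set M} (hW : IsOpen W) {t : M → ℂ}
    (ht : MDifferentiableOn 𝓘(ℂ, E) 𝓘(ℂ, ℂ) t W) {α : MForm 𝓘(ℝ, E) M ℂ k}
    (hα : α ∈ smoothFormsOn 𝓘(ℝ, E) ℂ W k) : t • α ∈ smoothFormsOn 𝓘(ℝ, E) ℂ W k :=
  fun_smul_complex_mem_smoothFormsOn (fun _ hx ↦ contMDiffAt_real_of_mdifferentiableOn_complex ht hW hx) hα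

end Leibniz

end Manifold

end Literature.Geometry.Kaehler

end
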